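import Literature.Topology.PlaneTopology.JordanSweepParity
import Literature.Probability.RandomPlanarGeometry.LoopConfigurations
import HarnessLib

/-!
# Close loops: periodic extensions, reparametrised Jordan loops, straight-line homotopies

Topic `Literature/Topology/PlaneTopology`; proofs + two small definitions (`Curve.perExt`, the
`1`-periodic extension `ℝ → E` of a based loop, and `Curve.ofPeriodic`, the based loop of a
`1`-periodic map). This is the glue between the metric side of DKKMO's loop space — closeness
`d(γ, γ') < ε` turned into explicit parametrisations by
`Curve.exists_orientation_shift_reparam_forall_dist_lt` (a time reversal, a base point `b` and
an increasing reparametrisation `φ`) — and the homotopy side of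
`JordanSweepParity.even_wind_concatPath_of_loopHomotopy`, whose data are `1`-periodic Jordan
parametrisations `γ, γ' : ℝ → ℂ` (`IsJordanLoop`) and a homotopy of closed curves between them:
(1) the periodic extension of a loop is continuous and `1`-periodic, and agrees with the loop on
`[0, 1]`; (2) if the periodic extension of `β` is a Jordan loop then so are those of
`β.reverse` and of `(β.shift b).reparam φ` (`isJordanLoop_perExt_reverse`,
`isJordanLoop_perExt_shift_reparam`); (3) the straight-line homotopy
`H τ s = (1 - τ) γ s + τ γ' s` between two `1`-periodic continuous maps is a homotopy of closed
curves which avoids every point at distance `≥ sup_s ‖γ s - γ' s‖` from the trace of `γ`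
(`straightHomotopy_ne`). Used in the transfer of quad crossings between close loop
configurations (`Literature.Probability.Percolation.dkkmo_crossing_rotation_invariance`).

## References

* H. Duminil-Copin, K. K. Kozlowski, D. Krachun, I. Manolescu, M. Oulamara, arXiv:2012.11672v2,
  §1.2 eq. (1) [arXiv201211672v2].
-/

noncomputable section

namespace Literature.Probability.RandomPlanarGeometry.Curve

open Set unitInterval Literature.Topology.PlaneTopology

variable {E : Type*} [MetricSpace E]

/-! ### The periodic extension of a based loop -/

/-- The `1`-periodic extension `ℝ → E` of a curve: `s ↦ γ.loopMap s`, i.e. `γ (fract s)`.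
[cite: arXiv201211672v2, §1.2 eq. (1)] -/
def perExt (γ : Curve E) (s : ℝ) : E := γ.loopMap (s : AddCircle (1 : ℝ))

/-- The periodic extension at `s` is the value at the fractional part. [folklore] -/
theorem perExt_apply (γ : Curve E) (s : ℝ) :
    γ.perExt s = γ ⟨Int.fract s, Int.fract_nonneg s, (Int.fract_lt_one s).le⟩ :=
  loopMap_coe_eq γ s

/-- The periodic extension is `1`-periodic. [folklore] -/
theorem periodic_perExt (γ : Curve E) : Function.Periodic γ.perExt 1 := fun s => by
  simp only [perExt, AddCircle.coe_add_period]

/-- The periodic extension of a loop is continuous. [folklore] -/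
theorem continuous_perExt {γ : Curve E} (hγ : γ.IsLoop) : Continuous γ.perExt := by
  change Continuous fun s : ℝ => γ.loopMap (s : AddCircle (1 : ℝ))
  exact (continuous_loopMap hγ).comp (by fun_prop)

/-- On `[0, 1]` the periodic extension of a loop is the loop. [folklore] -/
theorem perExt_apply_coe {γ : Curve E} (hγ : γ.IsLoop) (t : I) : γ.perExt t = γ t := by
  rw [perExt_apply]
  rcases lt_or_eq_of_le t.2.2 with h | h
  · congr 1
    exact Subtype.ext (Int.fract_eq_self.2 ⟨t.2.1, h⟩)
  · have h1 : t = 1 := Subtype.ext h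
    subst h1
    have h0 : (⟨Int.fract ((1 : I) : ℝ), Int.fract_nonneg _, (Int.fract_lt_one _).le⟩ : I) = 0 :=
      Subtype.ext (by simp)
    rw [h0]
    exact hγ

/-- On `[0, 1]` (real form) the periodic extension of a loop is the loop. [folklore] -/
theorem perExt_apply_of_mem_Icc {γ : Curve E} (hγ : γ.IsLoop) {s : ℝ} (hs : s ∈ Icc (0 : ℝ) 1) :
    γ.perExt s = γ ⟨s, hs⟩ :=
  perExt_apply_coe hγ ⟨s, hs⟩

/-- The range of the periodic extension of a loop is the range of the loop. [folklore] -/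
theorem range_perExt {γ : Curve E} (hγ : γ.IsLoop) : range γ.perExt = range γ := by
  ext x
  constructor
  · rintro ⟨s, rfl⟩
    rw [perExt_apply]
    exact ⟨_, rfl⟩
  · rintro ⟨t, rfl⟩
    exact ⟨t, perExt_apply_coe hγ t⟩

/-! ### The based loop of a periodic map -/

/-- The based loop (curve on `[0, 1]`) of a continuous map `ℝ → E`. [folklore] -/
def ofPeriodic (g : ℝ → E) (hg : Continuous g) : Curve E := ⟨⟨fun t : I => g t, hg.comp continuous_subtype_val⟩⟩

/-- Pointwise formula. [folklore] -/
@[simp] theorem ofPeriodic_apply (g : ℝ → E) (hg : Continuous g) (t : I) : ofPeriodic g hg t = g t := rfl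

/-- The based loop of a `1`-periodic map is a loop. [folklore] -/
theorem isLoop_ofPeriodic {g : ℝ → E} (hg : Continuous g) (hp : Function.Periodic g 1) :
    (ofPeriodic g hg).IsLoop := by
  change g (0 : I) = g (1 : I)
  have := hp 0
  simp only [zero_add] at this
  exact this.symm

/-- The periodic extension of the based loop of a `1`-periodic map is the map. [folklore] -/
theorem perExt_ofPeriodic {g : ℝ → E} (hg : Continuous g) (hp : Function.Periodic g 1) :
    (ofPeriodic g hg).perExt = g := by
  funext s
  rw [perExt_apply, ofPeriodic_apply]
  change g (Int.fract s) = g s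
  rw [Int.fract, show s - (⌊s⌋ : ℝ) = s - (⌊s⌋ : ℤ) * (1 : ℝ) by ring]
  exact hp.sub_int_mul_eq ⌊s⌋

/-! ### Jordan loops: injectivity modulo `1`, reversal, change of base point, reparametrisation -/

/-- **A Jordan loop identifies exactly the times with equal fractional parts.** [folklore] -/
theorem _root_.Literature.Topology.PlaneTopology.IsJordanLoop.apply_eq_apply_iff {γ : ℝ → ℂ}
    (h : IsJordanLoop γ) (x y : ℝ) : γ x = γ y ↔ Int.fract x = Int.fract y := by
  have hx : γ x = γ (Int.fract x) := by
    rw [Int.fract, show x - (⌊x⌋ : ℝ) = x - (⌊x⌋ : ℤ) * (1 : ℝ) by ring]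
    exact (h.periodic.sub_int_mul_eq ⌊x⌋).symm
  have hy : γ y = γ (Int.fract y) := by
    rw [Int.fract, show y - (⌊y⌋ : ℝ) = y - (⌊y⌋ : ℤ) * (1 : ℝ) by ring]
    exact (h.periodic.sub_int_mul_eq ⌊y⌋).symm
  rw [hx, hy]
  constructor
  · intro hxy
    exact h.injOn ⟨Int.fract_nonneg x, Int.fract_lt_one x⟩ ⟨Int.fract_nonneg y, Int.fract_lt_one y⟩ hxy
  · intro hxy
    rw [hxy]

/-- A continuous `1`-periodic map which identifies only times with equal fractional parts is a
Jordan loop. [folklore] -/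
theorem _root_.Literature.Topology.PlaneTopology.IsJordanLoop.of_apply_eq_apply_iff {γ : ℝ → ℂ}
    (hc : Continuous γ) (hp : Function.Periodic γ 1)
    (h : ∀ x y, γ x = γ y → Int.fract x = Int.fract y) : IsJordanLoop γ :=
  ⟨hc, hp, fun x hx y hy hxy => by
    have := h x y hxy
    rwa [Int.fract_eq_self.2 hx, Int.fract_eq_self.2 hy] at this⟩

/-- **Time reversal of a Jordan loop is a Jordan loop.** [folklore] -/
theorem _root_.Literature.Topology.PlaneTopology.IsJordanLoop.comp_neg {γ : ℝ → ℂ}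
    (h : IsJordanLoop γ) : IsJordanLoop fun s => γ (-s) := by
  refine IsJordanLoop.of_apply_eq_apply_iff (h.continuous.comp (by fun_prop))
    (fun s => by simp only [neg_add]; exact h.periodic.sub_eq (-s)) fun x y hxy => ?_
  have key := (h.apply_eq_apply_iff _ _).1 hxy
  rw [Int.fract_eq_fract] at key ⊢
  obtain ⟨z, hz⟩ := key
  exact ⟨-z, by push_cast; linarith⟩

/-- **Change of base point of a Jordan loop is a Jordan loop.** [folklore] -/
theorem _root_.Literature.Topology.PlaneTopology.IsJordanLoop.comp_add {γ : ℝ → ℂ}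
    (h : IsJordanLoop γ) (b : ℝ) : IsJordanLoop fun s => γ (s + b) := by
  refine IsJordanLoop.of_apply_eq_apply_iff (h.continuous.comp (by fun_prop))
    (fun s => by simp only [add_right_comm s 1 b]; exact h.periodic (s + b)) fun x y hxy => ?_
  have key := (h.apply_eq_apply_iff _ _).1 hxy
  rw [Int.fract_eq_fract] at key ⊢
  obtain ⟨z, hz⟩ := key
  exact ⟨z, by linarith⟩

/-- The periodic extension of the time reversal is the time reversal of the periodic extension.
[folklore] -/
theorem perExt_reverse {β : Curve E} (hβ : β.IsLoop) : β.reverse.perExt = fun s => β.perExt (-s) := by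
  funext s
  rw [perExt_apply, perExt_apply, reverse_apply]
  by_cases h0 : Int.fract s = 0
  · -- both sides are `β 1 = β 0`
    have h1 : Int.fract (-s) = 0 := Int.fract_neg_eq_zero.2 h0
    have eσ : unitInterval.symm ⟨Int.fract s, Int.fract_nonneg s, (Int.fract_lt_one s).le⟩ = 1 :=
      Subtype.ext (by simp [h0])
    have e0 : (⟨Int.fract (-s), Int.fract_nonneg _, (Int.fract_lt_one _).le⟩ : I) = 0 := Subtype.ext h1
    rw [eσ, e0]
    exact hβ.symm
  · congr 1
    exact Subtype.ext (by simp [Int.fract_neg h0])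

/-- The periodic extension of a shifted loop is the shifted periodic extension. [folklore] -/
theorem perExt_shift {β : Curve E} (hβ : β.IsLoop) (b : ℝ) :
    (β.shift b).perExt = fun s => β.perExt (s + b) := by
  funext s
  rw [perExt_apply, shift_apply hβ, perExt]
  congr 1
  rw [eq_comm, ← sub_eq_zero, ← AddCircle.coe_sub, AddCircle.coe_eq_zero_iff]
  refine ⟨⌊s⌋, ?_⟩
  rw [zsmul_eq_mul, mul_one]
  have := Int.self_sub_fract s
  linarith

/-- An increasing reparametrisation fixes `1`, hence maps `[0, 1)` to itself. [folklore] -/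
theorem orderIso_lt_one {φ : I ≃o I} {t : I} (ht : (t : ℝ) < 1) : ((φ t : I) : ℝ) < 1 := by
  have htop : φ ⊤ = ⊤ := map_top φ
  have hne : t ≠ ⊤ := fun h => by rw [h] at ht; exact lt_irrefl _ ht
  have : φ t ≠ ⊤ := fun h => hne (φ.injective (h.trans htop.symm))
  exact lt_of_le_of_ne (φ t).2.2 fun h => this (Subtype.ext h)

/-- **Reparametrising and re-basing a Jordan loop gives a Jordan loop**: if the periodic
extension of the loop `β` is a Jordan loop, so is that of `(β.shift b).reparam φ` for every base
point `b` and increasing reparametrisation `φ` of `[0, 1]`. [folklore] -/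
theorem isJordanLoop_perExt_shift_reparam {β : Curve ℂ} (hβ : β.IsLoop)
    (hJ : IsJordanLoop β.perExt) (b : ℝ) (φ : I ≃o I) :
    IsJordanLoop ((β.shift b).reparam φ).perExt := by
  have hL : ((β.shift b).reparam φ).IsLoop := isLoop_reparam (isLoop_shift hβ b) φ
  refine ⟨continuous_perExt hL, periodic_perExt _, fun x hx y hy hxy => ?_⟩
  rw [perExt_apply_of_mem_Icc hL ⟨hx.1, hx.2.le⟩, perExt_apply_of_mem_Icc hL ⟨hy.1, hy.2.le⟩,
    reparam_apply, reparam_apply] at hxy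
  -- `β.shift b (φ x) = β.perExt (φ x + b)`
  have e : ∀ u : I, β.shift b u = β.perExt (u + b) := fun u => by
    rw [← perExt_apply_coe (isLoop_shift hβ b) u, perExt_shift hβ]
  rw [e, e] at hxy
  have key := ((hJ.comp_add b).apply_eq_apply_iff _ _).1 hxy
  rw [Int.fract_eq_self.2 ⟨(φ ⟨x, hx.1, hx.2.le⟩).2.1, orderIso_lt_one hx.2⟩,
    Int.fract_eq_self.2 ⟨(φ ⟨y, hy.1, hy.2.le⟩).2.1, orderIso_lt_one hy.2⟩] at key
  have := φ.injective (Subtype.ext key)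
  exact congrArg Subtype.val this

/-- **Reversing a Jordan loop gives a Jordan loop** (periodic extensions). [folklore] -/
theorem isJordanLoop_perExt_reverse {β : Curve ℂ} (hβ : β.IsLoop) (hJ : IsJordanLoop β.perExt) :
    IsJordanLoop β.reverse.perExt := by
  rw [perExt_reverse hβ]
  exact hJ.comp_neg

/-! ### The straight-line homotopy between two close loops -/

/-- The straight-line homotopy `H τ s = (1 - τ) γ s + τ γ' s`. [folklore] -/
def straightHomotopy (γ γ' : ℝ → ℂ) (τ s : ℝ) : ℂ := (1 - (τ : ℂ)) * γ s + (τ : ℂ) * γ' s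

/-- Joint continuity on the square (indeed everywhere). [folklore] -/
theorem continuousOn_straightHomotopy {γ γ' : ℝ → ℂ} (hγ : Continuous γ) (hγ' : Continuous γ') :
    ContinuousOn (Function.uncurry (straightHomotopy γ γ')) (Icc 0 1 ×ˢ Icc 0 1) := by
  apply Continuous.continuousOn
  unfold straightHomotopy Function.uncurry
  fun_prop

/-- At `τ = 0` the homotopy is `γ`. [folklore] -/
@[simp] theorem straightHomotopy_zero (γ γ' : ℝ → ℂ) (s : ℝ) : straightHomotopy γ γ' 0 s = γ s := by
  simp [straightHomotopy]

/-- At `τ = 1` the homotopy is `γ'`. [folklore] -/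
@[simp] theorem straightHomotopy_one (γ γ' : ℝ → ℂ) (s : ℝ) : straightHomotopy γ γ' 1 s = γ' s := by
  simp [straightHomotopy]

/-- The intermediate curves are closed when `γ`, `γ'` are `1`-periodic. [folklore] -/
theorem straightHomotopy_zero_eq_one {γ γ' : ℝ → ℂ} (hγ : Function.Periodic γ 1)
    (hγ' : Function.Periodic γ' 1) (τ : ℝ) : straightHomotopy γ γ' τ 0 = straightHomotopy γ γ' τ 1 := by
  have h1 := hγ 0
  have h2 := hγ' 0
  simp only [zero_add] at h1 h2
  simp [straightHomotopy, h1, h2]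

/-- **The straight-line homotopy stays within the sup distance of `γ`.** [folklore] -/
theorem dist_straightHomotopy_le {γ γ' : ℝ → ℂ} {τ : ℝ} (hτ : τ ∈ Icc (0 : ℝ) 1) (s : ℝ) :
    dist (straightHomotopy γ γ' τ s) (γ s) ≤ dist (γ' s) (γ s) := by
  rw [straightHomotopy, Complex.dist_eq, Complex.dist_eq,
    show (1 - (τ : ℂ)) * γ s + (τ : ℂ) * γ' s - γ s = (τ : ℂ) * (γ' s - γ s) by ring, norm_mul,
    Complex.norm_real, Real.norm_of_nonneg hτ.1]
  exact mul_le_of_le_one_left (norm_nonneg _) hτ.2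

/-- **The straight-line homotopy between `ρ`-close loops avoids every point at distance `≥ ρ`
from the trace of `γ`.** [folklore] -/
theorem straightHomotopy_ne {γ γ' : ℝ → ℂ} {ρ : ℝ} (hclose : ∀ s, dist (γ' s) (γ s) < ρ) {z : ℂ}
    (hz : ∀ s, ρ ≤ dist z (γ s)) {τ : ℝ} (hτ : τ ∈ Icc (0 : ℝ) 1) (s : ℝ) :
    straightHomotopy γ γ' τ s ≠ z := by
  intro h
  have := (dist_straightHomotopy_le (γ := γ) (γ' := γ') hτ s).trans_lt (hclose s)
  rw [h] at this
  exact (lt_irrefl _) ((hz s).trans_lt this)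

end Literature.Probability.RandomPlanarGeometry.Curve
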